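import Summits.QuantumFields.BalabanUV.T4Continuum.Support.VariationalCovariantFederbush

/-!
# T⁴ programme, spine node NE2 (U1a), lane P2 — SUPPLIER LEAF ONE⁺ OF THE VARIATIONAL ROUTE, PART 0: the centred interpolation WEIGHTS
# `w_L(i) = (2i+1−L)/(2L)`, their bookkeeping over block offsets, and the covariant CROSS-TERM IDENTITY (U(1), unit phases)

NE2 formalisation swarm `b2b-balaban-t4-ne2-formalise-*`, leaf 01 GEN 2 (`prover-b2b-balaban-t4-ne2-formalise-leaf-01-g2-0`), SUPPLIER SEAT for
leaf ONE⁺ («s5», one-step consistency by an explicit covariant competitor) of the P2 (variational) skeleton `t4/skeletons/NE2-t4-ne2-p2.md`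
v0.6 §2.C ∕ §7; journal CLAIM CLAIMS.log l.8374 (+ erratum l.8383).  This is the elementary bookkeeping module of the leaf (split off for the
400-line rule); the objects and the exact bond identities are in `VariationalCovariantInterpolant`, the sums and the END in
`VariationalCovariantOneStep`.  Carrier for §2: the coarse covariant difference `cD N Rc f y μ = Rc(y,μ)f(y+e_μ) − f(y)` of
`VariationalCovariantFederbush` ([Balaban1985BackgroundPropagators] (3.3) p.390, SHAPE only, abelian).

HONEST FRAMING (T4-DAG p. 1).  Rung (B)+1 only — NOT infinite volume, NOT a mass gap, NOT Clay.  Node NE2 is NOT IN PRINT and NOT proved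
here; nothing below is specific to it: (§1) the weights `w_L(i)` of the centred forward-Taylor interpolant — consecutive difference `1/L`
(`wt_succ_sub`), face jump `1 + w_L(0) − w_L(L−1) = 1/L` (`one_add_wt_zero_sub`), `|w_L| ≤ ½`, reflection antisymmetry and CENTRING
`Σ_i w_L(i) = 0` (`sum_wt`, `sum_wt_coord` — what makes the transported constraint exact), the face count `Σ_j [j_μ+1 = L] = L^{d−1}`
(`sum_ind_last`) and the weighted face count `sum_ind_wt_update` (what makes the main term's constant exactly 1); (§2) for UNIT bond phases
`Re Σ_y conj(G y)·(D⁺_μ G)(y) = −½·Σ_y |(D⁺_μ G)(y)|²` (`re_sum_conj_mul_cD`: expand the square, the shifted mass equals the mass).  All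
[folklore]; no `def … : Prop`; no `sorry`; axioms standard.  HONEST DEPENDENCY (cell, verbatim): continuum YM on T⁴ ⇐ BetaPertH ∧ nine
spine estimates (0/9 proved); BetaPertH ⇐ (D1) ∧ (D4) ∧ CAP+tail; G-an2-4 gates asym, D1 and NE2/3/4.
-/

noncomputable section

namespace Summit.QuantumFields.BalabanUV.T4Continuum.VariationalCovariantWeights

open Finset
open scoped ComplexConjugate
open Literature.MathematicalPhysics.QuantumFieldTheory.Balaban1983to89
open Literature.MathematicalPhysics.QuantumFieldTheory.Balaban1983to89.B5Prop11Plancherel (Tor fine unitVec)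
open Summit.QuantumFields.BalabanUV.T4Continuum.VariationalCovariantFederbush (cD)

variable {d : ℕ}

/-! ## §1 The centred linear weights `w_L(i) = (2i + 1 − L)/(2L)` and their bookkeeping over block offsets -/

section Weights

/-- the centred linear weight of the fine offset `i ∈ {0,…,L−1}`: `w_L(i) = (i − (L−1)/2)/L = (2i + 1 − L)/(2L)`. [folklore] -/
def wt (L : ℕ) (i : ℕ) : ℝ := (2 * (i : ℝ) + 1 - L) / (2 * L)

/-- consecutive weights differ by `1/L`. [folklore] -/
theorem wt_succ_sub (L : ℕ) [NeZero L] (i : ℕ) : wt L (i + 1) - wt L i = 1 / L := by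
  have hL : (L : ℝ) ≠ 0 := by exact_mod_cast NeZero.ne L
  unfold wt; push_cast; field_simp; ring

/-- across a block face: `1 + (w_L(0) − w_L(L−1)) = 1/L`. [folklore] -/
theorem one_add_wt_zero_sub (L : ℕ) [NeZero L] (i : ℕ) (h : i + 1 = L) : 1 + (wt L 0 - wt L i) = 1 / L := by
  have hL : (L : ℝ) ≠ 0 := by exact_mod_cast NeZero.ne L
  have hi : (i : ℝ) = L - 1 := by
    have := congrArg (Nat.cast (R := ℝ)) h; push_cast at this; linarith
  unfold wt; rw [hi]; push_cast; field_simp; ring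

/-- `|w_L(i)| ≤ 1/2` on a block. [folklore] -/
theorem abs_wt_le (L : ℕ) {i : ℕ} (hi : i < L) : |wt L i| ≤ 1 / 2 := by
  have hL : (0 : ℝ) < L := by exact_mod_cast Nat.zero_lt_of_lt hi
  have hi' : (i : ℝ) + 1 ≤ L := by exact_mod_cast hi
  have hi0 : (0 : ℝ) ≤ i := Nat.cast_nonneg i
  unfold wt
  rw [abs_le]
  constructor
  · rw [le_div_iff₀ (by positivity)]; nlinarith
  · rw [div_le_iff₀ (by positivity)]; nlinarith

/-- `−w_L(0) = (L−1)/(2L) ∈ [0, 1/2]`. [folklore] -/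
theorem neg_wt_zero_mem (L : ℕ) [NeZero L] : 0 ≤ -wt L 0 ∧ -wt L 0 ≤ 1 / 2 := by
  have hL : (1 : ℝ) ≤ L := by exact_mod_cast Nat.one_le_iff_ne_zero.mpr (NeZero.ne L)
  have hL0 : (0 : ℝ) < 2 * L := by positivity
  unfold wt
  have e : -((2 * ((0 : ℕ) : ℝ) + 1 - L) / (2 * L)) = ((L : ℝ) - 1) / (2 * L) := by push_cast; ring
  rw [e]
  constructor
  · exact div_nonneg (by linarith) hL0.le
  · rw [div_le_iff₀ hL0]; linarith

/-- reflection antisymmetry `w_L(L−1−i) = −w_L(i)`. [folklore] -/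
theorem wt_rev (L : ℕ) (i : Fin L) : wt L (Fin.rev i : ℕ) = -wt L i := by
  have hL : (0 : ℝ) < L := by exact_mod_cast Fin.pos i
  have hle : (i : ℕ) + 1 ≤ L := i.is_lt
  rw [Fin.val_rev]
  unfold wt
  rw [Nat.cast_sub hle]
  push_cast; field_simp; ring

/-- the weights are centred: `Σ_{i<L} w_L(i) = 0`. [folklore] -/
theorem sum_wt (L : ℕ) : ∑ i : Fin L, wt L i = 0 := by
  have h : ∑ i : Fin L, wt L i = ∑ i : Fin L, wt L (Fin.rev i : ℕ) :=
    (Fintype.sum_equiv Fin.revPerm _ _ fun i => rfl).symm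
  simp only [wt_rev, sum_neg_distrib] at h
  linarith

variable (L : ℕ)

/-- `Σ_{j ∈ (Fin L)^d} g(j_μ) = L^{d−1}·Σ_i g(i)` (product of sums; the real twin of `BlockPairingFaces.sum_pi_eval`). [folklore] -/
theorem sum_pi_eval (μ : Fin d) (g : Fin L → ℝ) :
    ∑ j : Fin d → Fin L, g (j μ) = (L : ℝ) ^ (d - 1) * ∑ i : Fin L, g i := by
  classical
  have h := Finset.prod_univ_sum (fun _ : Fin d => (Finset.univ : Finset (Fin L))) (fun ν i => if ν = μ then g i else (1 : ℝ))
  rw [Fintype.piFinset_univ] at h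
  have lhs : (∏ ν : Fin d, ∑ i : Fin L, if ν = μ then g i else (1 : ℝ)) = (L : ℝ) ^ (d - 1) * ∑ i : Fin L, g i := by
    rw [← Finset.mul_prod_erase Finset.univ _ (Finset.mem_univ μ)]
    simp only [if_true]
    have hrest : ∀ ν ∈ Finset.univ.erase μ, (∑ i : Fin L, if ν = μ then g i else (1 : ℝ)) = (L : ℝ) := by
      intro ν hν
      simp only [Finset.ne_of_mem_erase hν, if_false, Finset.sum_const, Finset.card_univ, Fintype.card_fin, nsmul_eq_mul, mul_one]
    rw [Finset.prod_congr rfl hrest, Finset.prod_const, Finset.card_erase_of_mem (Finset.mem_univ μ), Finset.card_univ,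
      Fintype.card_fin, mul_comm]
  have rhs : (∑ j : Fin d → Fin L, ∏ ν : Fin d, if ν = μ then g (j ν) else (1 : ℝ)) = ∑ j : Fin d → Fin L, g (j μ) := by
    refine Finset.sum_congr rfl fun j _ => ?_
    rw [Finset.prod_ite_eq']
    simp
  rw [← rhs, ← h, lhs]

/-- the weights are centred in every coordinate: `Σ_{j ∈ (Fin L)^d} w_L(j_ν) = 0`. [folklore] -/
theorem sum_wt_coord (ν : Fin d) : ∑ j : Fin d → Fin L, wt L (j ν) = 0 := by
  rw [sum_pi_eval L ν (fun i => wt L i), sum_wt, mul_zero]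

/-- the far face of a block holds `L^{d−1}` of its `L^d` offsets: `Σ_j [j_μ + 1 = L] = L^{d−1}`. [folklore] -/
theorem sum_ind_last [NeZero L] (μ : Fin d) :
    ∑ j : Fin d → Fin L, (if (j μ : ℕ) + 1 = L then (1 : ℝ) else 0) = (L : ℝ) ^ (d - 1) := by
  have hL : 0 < L := Nat.pos_of_ne_zero (NeZero.ne L)
  rw [sum_pi_eval L μ (fun i : Fin L => if (i : ℕ) + 1 = L then (1 : ℝ) else 0)]
  have h1 : ∑ i : Fin L, (if (i : ℕ) + 1 = L then (1 : ℝ) else 0) = 1 := by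
    rw [Fintype.sum_eq_single (⟨L - 1, Nat.sub_lt hL one_pos⟩ : Fin L)]
    · exact if_pos (Nat.sub_add_cancel hL)
    · intro i hi
      rw [if_neg]
      intro h
      apply hi
      ext
      show (i : ℕ) = L - 1
      omega
  rw [h1, mul_one]

/-- weighted face count: `Σ_j [j_μ + 1 = L]·w_L((j[μ ↦ 0])_ν)` equals `L^{d−1}·w_L(0)` for `ν = μ` and VANISHES for `ν ≠ μ` (reflection in
the `ν`-th offset). [folklore] -/
theorem sum_ind_wt_update [NeZero L] (μ ν : Fin d) :
    ∑ j : Fin d → Fin L, (if (j μ : ℕ) + 1 = L then (1 : ℝ) else 0) * wt L (Function.update j μ (0 : Fin L) ν)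
      = if ν = μ then (L : ℝ) ^ (d - 1) * wt L 0 else 0 := by
  classical
  by_cases hν : ν = μ
  · subst hν
    simp only [Function.update_self, Fin.val_zero, if_true]
    rw [← Finset.sum_mul, sum_ind_last L ν]
  · rw [if_neg hν]
    simp only [Function.update_of_ne hν]
    -- reflect the ν-th offset: the indicator is unchanged (it reads the μ-th), the weight changes sign
    let e : (Fin d → Fin L) ≃ (Fin d → Fin L) :=
      Equiv.piCongrRight fun κ => if κ = ν then Fin.revPerm else Equiv.refl (Fin L)
    have hμν : μ ≠ ν := Ne.symm hν
    have heμ : ∀ j : Fin d → Fin L, e j μ = j μ := by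
      intro j
      show (if μ = ν then Fin.revPerm else Equiv.refl (Fin L)) (j μ) = j μ
      rw [if_neg hμν]
      rfl
    have heν : ∀ j : Fin d → Fin L, e j ν = Fin.rev (j ν) := by
      intro j
      show (if ν = ν then Fin.revPerm else Equiv.refl (Fin L)) (j ν) = Fin.rev (j ν)
      rw [if_pos rfl]
      rfl
    have h : ∑ j : Fin d → Fin L, (if ((e j) μ : ℕ) + 1 = L then (1 : ℝ) else 0) * wt L ((e j) ν)
        = ∑ j : Fin d → Fin L, (if (j μ : ℕ) + 1 = L then (1 : ℝ) else 0) * wt L (j ν) :=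
      Fintype.sum_equiv e _ _ fun j => rfl
    simp only [heμ, heν, wt_rev, mul_neg, sum_neg_distrib] at h
    linarith

end Weights

/-! ## §2 The cross-term identity (unit phases): `Re Σ_y conj(G y)·(D⁺_μ G)(y) = −½·Σ_y |(D⁺_μ G)(y)|²` -/

section Cross

variable (N : Fin d → ℕ) [∀ μ, NeZero (N μ)]

/-- for unit bond phases, `2·Re Σ_y conj(G y)·(D⁺_μ G)(y) + Σ_y |(D⁺_μ G)(y)|² = 0` (expand the square; the shifted mass equals the
mass by translation invariance of the torus sum). [folklore] -/
theorem two_re_sum_conj_mul_cD_add {Rc : Tor N → Fin d → ℂ} (μ : Fin d) (hRc1 : ∀ y, ‖Rc y μ‖ = 1) (G : Tor N → ℂ) :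
    2 * (∑ y, conj (G y) * cD N Rc G y μ).re + ∑ y, ‖cD N Rc G y μ‖ ^ 2 = 0 := by
  have hshift : ∑ y : Tor N, ‖G (y + unitVec N μ)‖ ^ 2 = ∑ y : Tor N, ‖G y‖ ^ 2 :=
    Fintype.sum_equiv (Equiv.addRight (unitVec N μ)) _ _ fun y => rfl
  have h1 : ∀ y, ‖cD N Rc G y μ‖ ^ 2
      = ‖G (y + unitVec N μ)‖ ^ 2 + ‖G y‖ ^ 2 - 2 * (Rc y μ * G (y + unitVec N μ) * conj (G y)).re := by
    intro y
    unfold cD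
    rw [Complex.sq_norm, Complex.normSq_sub, Complex.normSq_eq_norm_sq, Complex.normSq_eq_norm_sq, norm_mul, hRc1, one_mul]
  have h2 : ∀ y, (conj (G y) * cD N Rc G y μ).re = (Rc y μ * G (y + unitVec N μ) * conj (G y)).re - ‖G y‖ ^ 2 := by
    intro y
    unfold cD
    rw [mul_sub, Complex.sub_re, mul_comm (conj (G y)) (Rc y μ * G (y + unitVec N μ)), ← Complex.normSq_eq_conj_mul_self,
      Complex.ofReal_re, Complex.normSq_eq_norm_sq]
  rw [Complex.re_sum]
  simp_rw [h2, h1]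
  rw [Finset.sum_sub_distrib, Finset.sum_sub_distrib, Finset.sum_add_distrib, hshift, ← Finset.mul_sum]
  ring

/-- **CROSS-TERM IDENTITY**: `Re Σ_y conj(G y)·(D⁺_μ G)(y) = −½·Σ_y |(D⁺_μ G)(y)|²` for unit bond phases. [folklore] -/
theorem re_sum_conj_mul_cD {Rc : Tor N → Fin d → ℂ} (μ : Fin d) (hRc1 : ∀ y, ‖Rc y μ‖ = 1) (G : Tor N → ℂ) :
    (∑ y, conj (G y) * cD N Rc G y μ).re = -(1 / 2) * ∑ y, ‖cD N Rc G y μ‖ ^ 2 := by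
  have h := two_re_sum_conj_mul_cD_add N μ hRc1 G
  linarith

end Cross

end Summit.QuantumFields.BalabanUV.T4Continuum.VariationalCovariantWeights

end
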